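import Mathlib
import HarnessLib
import Summits.Ventures.LatticeQCDFlow.Exactness.NCMCGeneralSpaceBarRestartChainsCLT
import Summits.Ventures.LatticeQCDFlow.Exactness.NCMCGeneralSpaceGammaMethodPlugIn
import Summits.Ventures.LatticeQCDFlow.Exactness.NCMCGeneralSpaceGammaMethodStudentizedCLT
import Summits.Ventures.LatticeQCDFlow.Exactness.NCMCGeneralSpaceRestartChainGammaCoverage
import Summits.Ventures.LatticeQCDFlow.Exactness.NCMCGeneralSpaceBennettRootStudentizedCLT
import Summits.Ventures.LatticeQCDFlow.Scoring.DeltaMethod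

/-!
# The BAR lane along CORRELATED starts: the printed plug-in Γ-method error bar `ΔF̂_n ± z √(V̂_n/n) / Ĝ_n` is asymptotically exact from EVERY initial law of the first record pair

HONEST FRAMING: exact (Metropolis-corrected) sampling algorithms for lattice gauge theory;
figures of merit are autocorrelation/cost numbers at stated couplings and volumes; no
continuum-physics claim.

Venture `LatticeQCDFlow` (cell pub-lqcd), topic `Exactness`; FANOUT row 13 (`eng-snf`, GEN-22).
NEW WORK of the cell, not a published result; no definition is introduced; nothing is cited as a
fact (Bennett 1976 NAMED ONLY).  GEN-22's `NCMCGeneralSpaceBarRestartChainsCLT` proved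
`√n (ΔF̂_n − ΔF) ⇒ N(0, σ²_pair / G²)` for the Bennett root `ΔF̂_n` computed from two INDEPENDENT
streams of CORRELATED launches (the pair chain `R₀ ∥ₖ R₁`), `G` the overlap, `σ²_pair` the
Green–Kubo variance of the Bennett summand `ψ_{ΔF}(ω, ω') = σ(ΔF − W ω) − σ(W ω' − ΔF)` along the
pair chain, and stated "NOT CLAIMED: a consistent estimator of `σ²_pair`".  THIS FILE supplies it and
closes the lane: the scorer's Γ-method statistic `V̂_n = Γ̂_n(0) · 2 τ̂_{n,W_n}` computed on the
PLUG-IN series `ψ_{ΔF̂_n}(ω_i, ω'_i)` (the summand at the REPORTED root) converges in probability to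
`σ²_pair` (GEN-20's consistency for the fixed observable `ψ_{ΔF}` + the plug-in comparison of
`NCMCGeneralSpaceGammaMethodPlugIn`, `|V̂_n − V_n| ≤ 8 (W_n + 1) |ΔF̂_n − ΔF|`, + `W_n (ΔF̂_n − ΔF) → 0`
in probability from the CLT since `W_n²/n → 0`), the plug-in overlap
`Ĝ_n = (1/n) Σ_{i<n} σ(ΔF̂_n − W ω_i)` converges in probability to `G` (chain law of large numbers +
`σ` is `¼`-Lipschitz), and Slutsky's theorem gives the studentized limit `N(0, 1)`.

## Content (hypotheses of `CrooksPair.tendstoInDistribution_sqrt_mul_barRoot_sub_restartChains`,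
## plus `σ²_pair > 0`, windows `W_n → ∞` with `W_n³/n → 0`, `z > 0`)

* **`CrooksPair.tendsto_measure_barRoot_mem_gammaInterval_restartChains`** — for EVERY initial law
  `μ₀` of the first record pair:
  `P_{μ₀}{ |ΔF̂_n − ΔF| ≤ z √(V̂_n / n) / Ĝ_n } → gaussianReal 0 1 (Icc (−z) z)`.

Reading (value-free): along two correlated streams the honest BAR error bar is the Γ-method error of
the plug-in Bennett summand series of the PAIRED records divided by the plug-in overlap; with
independent launches it reduces to GEN-15's `√((1/Ĝ − 2)/n)`.  NOT CLAIMED: `σ²_pair > 0` (assumed;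
it fails only for degenerate protocols); unequal stream lengths; data-driven windows (clip them:
GEN-20 `NCMCGeneralSpaceGammaMethodDataWindow`); Berry–Esseen rates; anything numerical.
-/

namespace Summit.Ventures.LatticeQCDFlow.Exactness.GeneralNCMC

open MeasureTheory ProbabilityTheory Set Filter Finset
open scoped ENNReal NNReal Topology

variable {Ω E : Type*} [MeasurableSpace Ω] [MeasurableSpace E]

/-- `√n / (W_n + 1) → ∞` when `W_n → ∞` and `W_n³ / n → 0`. -/
theorem tendsto_sqrt_div_window_atTop {Wn : ℕ → ℕ} (hW : Tendsto Wn atTop atTop)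
    (hW3 : Tendsto (fun n => (Wn n : ℝ) ^ 3 / n) atTop (𝓝 0)) :
    Tendsto (fun n : ℕ => Real.sqrt n / ((Wn n : ℝ) + 1)) atTop atTop := by
  -- `(W_n + 1)² / n → 0`
  have h1 : Tendsto (fun n : ℕ => ((Wn n : ℝ) + 1) ^ 2 / n) atTop (𝓝 0) := by
    have h4 : Tendsto (fun n : ℕ => 4 * ((Wn n : ℝ) ^ 3 / n)) atTop (𝓝 0) := by
      simpa using hW3.const_mul (4 : ℝ)
    have hev : ∀ᶠ n : ℕ in atTop, ((Wn n : ℝ) + 1) ^ 2 / n ≤ 4 * ((Wn n : ℝ) ^ 3 / n) := by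
      filter_upwards [hW.eventually_ge_atTop 1] with n hn
      have hw : (1 : ℝ) ≤ Wn n := by exact_mod_cast hn
      rw [← mul_div_assoc]
      refine div_le_div_of_nonneg_right ?_ (Nat.cast_nonneg n)
      nlinarith [hw, sq_nonneg ((Wn n : ℝ) - 1)]
    exact tendsto_of_tendsto_of_tendsto_of_le_of_le' tendsto_const_nhds h4
      (Eventually.of_forall fun n => by positivity) hev
  have h2 : ∀ᶠ n : ℕ in atTop, ((Wn n : ℝ) + 1) ^ 2 / n ∈ Ioi (0 : ℝ) := by
    filter_upwards [Filter.eventually_gt_atTop 0] with n hn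
    have hn' : (0 : ℝ) < n := by exact_mod_cast hn
    exact div_pos (by positivity) hn'
  have h3 : Tendsto (fun n : ℕ => (((Wn n : ℝ) + 1) ^ 2 / n)⁻¹) atTop atTop :=
    (tendsto_nhdsWithin_iff.2 ⟨h1, h2⟩).inv_tendsto_nhdsGT_zero
  refine (Real.tendsto_sqrt_atTop.comp h3).congr' ?_
  filter_upwards [Filter.eventually_gt_atTop 0] with n hn
  have hw : (0 : ℝ) < (Wn n : ℝ) + 1 := by positivity
  simp only [Function.comp_apply]
  rw [inv_div, Real.sqrt_div' _ (sq_nonneg _), Real.sqrt_sq hw.le]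

/-- `|σ a − σ b| ≤ 1`. -/
theorem abs_sigmoid_sub_sigmoid_le_one (a b : ℝ) : |Real.sigmoid a - Real.sigmoid b| ≤ 1 :=
  abs_sub_le_iff.2 ⟨by linarith [Real.sigmoid_le_one a, Real.sigmoid_nonneg b],
    by linarith [Real.sigmoid_le_one b, Real.sigmoid_nonneg a]⟩

namespace CrooksPair

variable {ν₀ ν₁ : Measure Ω} [IsFiniteMeasure ν₀] [IsFiniteMeasure ν₁] {κF κR : Kernel Ω E}
  [IsMarkovKernel κF] [IsMarkovKernel κR] {s e : E → Ω} {W : E → ℝ}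

/-- **THE PRINTED PLUG-IN Γ-METHOD INTERVAL OF THE BAR LANE ALONG TWO INDEPENDENT STREAMS OF CORRELATED
LAUNCHES IS ASYMPTOTICALLY EXACT, FROM EVERY INITIAL LAW OF THE FIRST RECORD PAIR.**  Crooks pair with
`Z₀, Z₁ ≠ 0`, `e^{−ΔF} = Z₁/Z₀`; `K₀` `ν₀`-invariant and `K₁` `ν₁`-invariant Markov level samplers
dominating non-zero finite `m₀`, `m₁` from every configuration; `d̂_n` any measurable root selection of
the sample Bennett equation; `σ²_pair > 0`; windows `W_n → ∞`, `W_n³/n → 0`; `z > 0`.  With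
`V̂_n = Γ̂_n(0) · 2 τ̂_{n,W_n}` computed on the plug-in series `σ(d̂_n − W ω_i) − σ(W ω'_i − d̂_n)` and
`Ĝ_n = (1/n) Σ_{i<n} σ(d̂_n − W ω_i)`:
`P_{μ₀}{ |d̂_n − ΔF| ≤ z √(V̂_n / n) / Ĝ_n } → gaussianReal 0 1 (Icc (−z) z)`. -/
theorem tendsto_measure_barRoot_mem_gammaInterval_restartChains (K₀ K₁ : Kernel Ω Ω)
    [IsMarkovKernel K₀] [IsMarkovKernel K₁] (h0 : ν₀ univ ≠ 0) (h1 : ν₁ univ ≠ 0)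
    (hK₀ : Kernel.Invariant K₀ ν₀) (hK₁ : Kernel.Invariant K₁ ν₁) (h : CrooksPair ν₀ ν₁ κF κR s e W)
    {ΔF : ℝ} (hΔF : Real.exp (-ΔF) = ((ν₀ univ)⁻¹ * ν₁ univ).toReal)
    {m₀ m₁ : Measure Ω} [IsFiniteMeasure m₀] [IsFiniteMeasure m₁] (hm₀ : m₀ univ ≠ 0)
    (hm₁ : m₁ univ ≠ 0) (hmin₀ : ∀ z, m₀ ≤ K₀ z) (hmin₁ : ∀ z, m₁ ≤ K₁ z)
    {dhat : ℕ → (ℕ → E × E) → ℝ} (hdm : ∀ n, Measurable (dhat n))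
    (hdhat : ∀ n, 1 ≤ n → ∀ ω, (∑ i ∈ range n, Real.sigmoid (dhat n ω - W (ω i).1)) -
      ∑ i ∈ range n, Real.sigmoid (W (ω i).2 - dhat n ω) = 0)
    (hσ : 0 < (∫ p, (Real.sigmoid (ΔF - W p.1) - Real.sigmoid (W p.2 - ΔF)) ^ 2
          ∂((fwdPathLaw ν₀ κF).prod (fwdPathLaw ν₁ κR)))
        + 2 * ∑' k, ∫ p, (Real.sigmoid (ΔF - W p.1) - Real.sigmoid (W p.2 - ΔF))
          * (Scoring.kop (((κF ∘ₖ K₀).comap s h.measurable_s) ∥ₖ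
              ((κR ∘ₖ K₁).comap e h.measurable_e)))^[k + 1]
            (fun p => Real.sigmoid (ΔF - W p.1) - Real.sigmoid (W p.2 - ΔF)) p
          ∂((fwdPathLaw ν₀ κF).prod (fwdPathLaw ν₁ κR)))
    {Wn : ℕ → ℕ} (hW : Tendsto Wn atTop atTop)
    (hW3 : Tendsto (fun n => (Wn n : ℝ) ^ 3 / n) atTop (𝓝 0)) {z : ℝ} (hz : 0 < z)
    (μ₀ : Measure (E × E)) [IsProbabilityMeasure μ₀]
    [IsProbabilityMeasure (Kernel.trajMeasure (X := fun _ : ℕ => E × E) μ₀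
        (fun n : ℕ => (((κF ∘ₖ K₀).comap s h.measurable_s) ∥ₖ ((κR ∘ₖ K₁).comap e h.measurable_e)).comap
          (fun hh : (j : ↥(Finset.Iic n)) → E × E => hh ⟨n, Finset.mem_Iic.2 le_rfl⟩)
          (measurable_pi_apply _)))] :
    Tendsto (fun n : ℕ => (Kernel.trajMeasure (X := fun _ : ℕ => E × E) μ₀
        (fun n : ℕ => (((κF ∘ₖ K₀).comap s h.measurable_s) ∥ₖ ((κR ∘ₖ K₁).comap e h.measurable_e)).comap
          (fun hh : (j : ↥(Finset.Iic n)) → E × E => hh ⟨n, Finset.mem_Iic.2 le_rfl⟩)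
          (measurable_pi_apply _)))
        {ω : ℕ → E × E | |dhat n ω - ΔF|
          ≤ z * Real.sqrt (Scoring.gammaHat (fun i => Real.sigmoid (dhat n ω - W (ω i).1)
                - Real.sigmoid (W (ω i).2 - dhat n ω)) n 0
              * (2 * Scoring.tauIntWindow (Scoring.rhoHat (fun i => Real.sigmoid (dhat n ω - W (ω i).1)
                - Real.sigmoid (W (ω i).2 - dhat n ω)) n) (Wn n)) / n)
            / ((∑ i ∈ range n, Real.sigmoid (dhat n ω - W (ω i).1)) / n)})
      atTop (𝓝 (gaussianReal 0 1 (Icc (-z) z))) := by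
  haveI := isProbabilityMeasure_fwdPathLaw ν₀ h0 κF
  haveI := isProbabilityMeasure_fwdPathLaw ν₁ h1 κR
  set κp := ((κF ∘ₖ K₀).comap s h.measurable_s) ∥ₖ ((κR ∘ₖ K₁).comap e h.measurable_e) with hκp
  set πp := (fwdPathLaw ν₀ κF).prod (fwdPathLaw ν₁ κR) with hπp
  set P := Kernel.trajMeasure (X := fun _ : ℕ => E × E) μ₀
    (fun n : ℕ => κp.comap (fun hh : (j : ↥(Finset.Iic n)) → E × E => hh ⟨n, Finset.mem_Iic.2 le_rfl⟩)
      (measurable_pi_apply _)) with hP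
  -- the pair chain: invariance and one-step minorisation (GEN-16 / GEN-18), as in the CLT file
  have hI₀ := h.invariant_restartKernel K₀ hK₀
  have hI₁ := h.invariant_restartKernel_rev K₁ hK₁
  have hinv : Kernel.Invariant κp πp := invariant_parallelComp _ _ hI₀ hI₁
  haveI : IsFiniteMeasure (m₀.bind κF) := inferInstance
  haveI : IsFiniteMeasure (m₁.bind κR) := inferInstance
  have hprod : ((m₀.bind κF).prod (m₁.bind κR)) univ ≠ 0 :=
    prod_apply_univ_ne_zero (by rw [bind_apply_univ_of_markov]; exact hm₀)
      (by rw [bind_apply_univ_of_markov]; exact hm₁)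
  haveI : IsProbabilityMeasure ((((m₀.bind κF).prod (m₁.bind κR)) univ)⁻¹ •
      (m₀.bind κF).prod (m₁.bind κR)) :=
    ⟨by rw [Measure.smul_apply, smul_eq_mul, ENNReal.inv_mul_cancel hprod (measure_ne_top _ _)]⟩
  have hD : ∀ p, ((m₀.bind κF).prod (m₁.bind κR)) univ • ((((m₀.bind κF).prod (m₁.bind κR)) univ)⁻¹ •
      (m₀.bind κF).prod (m₁.bind κR)) ≤ nHit κp 1 p :=
    smul_normalised_prod_le_nHit_one ((κF ∘ₖ K₀).comap s h.measurable_s)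
      ((κR ∘ₖ K₁).comap e h.measurable_e) hprod (measure_le_comp_comap K₀ κF h.measurable_s hmin₀)
      (measure_le_comp_comap K₁ κR h.measurable_e hmin₁)
  haveI : Nonempty (E × E) := nonempty_of_isProbabilityMeasure μ₀
  have hε1 : ((m₀.bind κF).prod (m₁.bind κR)) univ ≤ 1 := by
    haveI := isMarkovKernel_nHit κp 1
    exact eps_le_one_of_minorised hD
  -- the Bennett summand at `ΔF`, the overlap `G > 0`
  have hσm : Measurable Real.sigmoid := _root_.continuous_sigmoid.measurable
  set ψ : E × E → ℝ := fun p => Real.sigmoid (ΔF - W p.1) - Real.sigmoid (W p.2 - ΔF) with hψ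
  have hψm : Measurable ψ := (hσm.comp (measurable_const.sub (h.measurable_W.comp measurable_fst))).sub
    (hσm.comp ((h.measurable_W.comp measurable_snd).sub measurable_const))
  have hψb : ∀ p, |ψ p| ≤ 1 := fun p => abs_sigmoid_sub_sigmoid_le_one _ _
  set G : ℝ := ∫ ε, Real.sigmoid (ΔF - W ε) ∂(fwdPathLaw ν₀ κF) with hGdef
  have hGpos : 0 < G := h.overlap_pos h0 ΔF
  set σ2 : ℝ := (∫ p, (Real.sigmoid (ΔF - W p.1) - Real.sigmoid (W p.2 - ΔF)) ^ 2 ∂πp)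
    + 2 * ∑' k, ∫ p, (Real.sigmoid (ΔF - W p.1) - Real.sigmoid (W p.2 - ΔF))
      * (Scoring.kop κp)^[k + 1] (fun p => Real.sigmoid (ΔF - W p.1) - Real.sigmoid (W p.2 - ΔF)) p ∂πp
    with hσ2
  -- (1) the CLT along the pair chain (GEN-22), canonical Gaussian variable
  have hU := h.tendstoInDistribution_sqrt_mul_barRoot_sub_restartChains K₀ K₁ h0 h1 hK₀ hK₁ hΔF hm₀ hm₁
    hmin₀ hmin₁ hdm hdhat μ₀ (P' := gaussianReal 0 (Real.toNNReal (σ2 / G ^ 2))) (Y := id) HasLaw.id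
  -- (2) `(W_n + 1)(d̂_n − ΔF) → 0` in probability
  have hT : TendstoInMeasure P (fun n ω => ((Wn n : ℝ) + 1) * (dhat n ω - ΔF)) atTop
      (fun _ => (0 : ℝ)) := by
    have hsc := Scoring.CardConsistency.tendstoInMeasure_of_tendstoInDistribution_scaled
      (P := P) (X := fun n ω => ΔF + ((Wn n : ℝ) + 1) * (dhat n ω - ΔF)) (θ := ΔF)
      (tendsto_sqrt_div_window_atTop hW hW3)
      (hU.congr (fun n => Eventually.of_forall fun ω => by
        have hw : ((Wn n : ℝ) + 1) ≠ 0 := by positivity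
        show Real.sqrt n * (dhat n ω - ΔF)
          = Real.sqrt n / ((Wn n : ℝ) + 1) * (ΔF + ((Wn n : ℝ) + 1) * (dhat n ω - ΔF) - ΔF)
        field_simp
        ring) Filter.EventuallyEq.rfl)
    rw [tendstoInMeasure_iff_norm] at hsc ⊢
    intro ε hε
    refine (hsc ε hε).congr fun n => ?_
    congr 1
    ext ω
    simp only [Set.mem_setOf_eq, add_sub_cancel_left, sub_zero]
  -- (3) the plug-in variance statistic converges in probability to `σ²_pair`
  have hcons := chain_gammaWindow_tendstoInMeasure_of_nHit μ₀ (fun z B hB => minorised_setwise hD z hB)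
    (pos_iff_ne_zero.2 hprod) hε1 Nat.one_pos hinv hψm hψb hW hW3
  have hroot : ∫ p, ψ p ∂πp = 0 := by
    have hmarg := chain_map_eval_of_invariant _ hinv 0
    rw [hψ, ← hmarg, integral_barSummand_eq h.measurable_W (map_fst_eval_chain_prod _ _ hI₀ hI₁)
      (map_snd_eval_chain_prod _ _ hI₀ hI₁), (h.integral_sigmoid_fwd_eq_rev_iff h0 h1 hΔF ΔF).2 rfl,
      sub_self]
  have hA : Scoring.autocov κp πp (fun y => ψ y - ∫ z, ψ z ∂πp) 0
      + 2 * ∑' t, Scoring.autocov κp πp (fun y => ψ y - ∫ z, ψ z ∂πp) (t + 1) = σ2 := by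
    rw [hroot]
    simp only [sub_zero, hσ2, hψ]
    unfold Scoring.autocov
    simp only [Function.iterate_zero, id_eq, sq]
  rw [hA] at hcons
  set Vh : ℕ → (ℕ → E × E) → ℝ := fun n ω =>
    Scoring.gammaHat (fun i => Real.sigmoid (dhat n ω - W (ω i).1) - Real.sigmoid (W (ω i).2 - dhat n ω)) n 0
      * (2 * Scoring.tauIntWindow (Scoring.rhoHat (fun i => Real.sigmoid (dhat n ω - W (ω i).1)
        - Real.sigmoid (W (ω i).2 - dhat n ω)) n) (Wn n)) with hVh
  have hVdiff : TendstoInMeasure P (fun n ω => Vh n ω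
      - Scoring.gammaHat (fun i => ψ (ω i)) n 0
        * (2 * Scoring.tauIntWindow (Scoring.rhoHat (fun i => ψ (ω i)) n) (Wn n))) atTop
      (fun _ => (0 : ℝ)) := by
    refine tendstoInMeasure_zero_of_abs_le_mul hT (by norm_num : (0 : ℝ) < 8) fun n ω => ?_
    have hδ : 0 ≤ 1 / 2 * |dhat n ω - ΔF| := by positivity
    have hclose : ∀ i < n, |(Real.sigmoid (dhat n ω - W (ω i).1) - Real.sigmoid (W (ω i).2 - dhat n ω))
        - ψ (ω i)| ≤ 1 / 2 * |dhat n ω - ΔF| := by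
      intro i _
      have e1 := abs_sigmoid_sub_sigmoid_le (dhat n ω - W (ω i).1) (ΔF - W (ω i).1)
      have e2 := abs_sigmoid_sub_sigmoid_le (W (ω i).2 - dhat n ω) (W (ω i).2 - ΔF)
      rw [show dhat n ω - W (ω i).1 - (ΔF - W (ω i).1) = dhat n ω - ΔF by ring] at e1
      rw [show W (ω i).2 - dhat n ω - (W (ω i).2 - ΔF) = -(dhat n ω - ΔF) by ring, abs_neg] at e2
      calc |Real.sigmoid (dhat n ω - W (ω i).1) - Real.sigmoid (W (ω i).2 - dhat n ω) - ψ (ω i)|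
          = |(Real.sigmoid (dhat n ω - W (ω i).1) - Real.sigmoid (ΔF - W (ω i).1))
              - (Real.sigmoid (W (ω i).2 - dhat n ω) - Real.sigmoid (W (ω i).2 - ΔF))| := by
            rw [hψ]; ring_nf
        _ ≤ |Real.sigmoid (dhat n ω - W (ω i).1) - Real.sigmoid (ΔF - W (ω i).1)|
              + |Real.sigmoid (W (ω i).2 - dhat n ω) - Real.sigmoid (W (ω i).2 - ΔF)| := abs_sub _ _
        _ ≤ 1 / 4 * |dhat n ω - ΔF| + 1 / 4 * |dhat n ω - ΔF| := add_le_add e1 e2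
        _ = 1 / 2 * |dhat n ω - ΔF| := by ring
    have hb := abs_gammaWindow_sub_le_of_close hδ zero_le_one
      (fun i _ => abs_sigmoid_sub_sigmoid_le_one _ _) (fun i _ => hψb (ω i)) hclose (Wn n)
    rw [hVh]
    refine hb.trans ?_
    rw [abs_mul, abs_of_pos (by positivity : (0 : ℝ) < (Wn n : ℝ) + 1)]
    nlinarith [abs_nonneg (dhat n ω - ΔF), (Nat.cast_nonneg (Wn n) : (0 : ℝ) ≤ Wn n)]
  have hV : TendstoInMeasure P Vh atTop (fun _ => σ2) :=
    tendstoInMeasure_of_sub_tendstoInMeasure_zero hcons hVdiff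
  -- (4) the plug-in overlap converges in probability to `G`
  have hψi : ∀ n (i : ℕ), Measurable fun ω : ℕ → E × E =>
      Real.sigmoid (dhat n ω - W (ω i).1) - Real.sigmoid (W (ω i).2 - dhat n ω) := fun n i =>
    (hσm.comp ((hdm n).sub (h.measurable_W.comp (measurable_fst.comp (measurable_pi_apply i))))).sub
      (hσm.comp ((h.measurable_W.comp (measurable_snd.comp (measurable_pi_apply i))).sub (hdm n)))
  have hgi : ∀ n (i : ℕ), Measurable fun ω : ℕ → E × E => Real.sigmoid (dhat n ω - W (ω i).1) :=
    fun n i => hσm.comp ((hdm n).sub (h.measurable_W.comp (measurable_fst.comp (measurable_pi_apply i))))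
  have hGfix : TendstoInMeasure P (fun n (ω : ℕ → E × E) =>
      (∑ i ∈ range n, Real.sigmoid (ΔF - W (ω i).1)) / n) atTop (fun _ => G) := by
    have hφm : Measurable fun p : E × E => Real.sigmoid (ΔF - W p.1) :=
      hσm.comp (measurable_const.sub (h.measurable_W.comp measurable_fst))
    have hφi : Integrable (fun p : E × E => Real.sigmoid (ΔF - W p.1)) πp :=
      Scoring.integrable_of_bounded πp hφm (C := 1) fun p => by
        rw [abs_of_nonneg (Real.sigmoid_nonneg _)]; exact Real.sigmoid_le_one _
    have hae := tendsto_sum_div_anyLaw_of_nHit_minorised hinv hprod hD hφm hφi μ₀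
    have hGπ : ∫ p, Real.sigmoid (ΔF - W p.1) ∂πp = G := by
      rw [hπp, hGdef]
      exact integral_comp_of_measurePreserving (measurePreserving_fst (μ := fwdPathLaw ν₀ κF)
        (ν := fwdPathLaw ν₁ κR)) (g := fun a => Real.sigmoid (ΔF - W a))
        (hσm.comp (measurable_const.sub h.measurable_W)).aestronglyMeasurable
    rw [hGπ] at hae
    exact tendstoInMeasure_of_tendsto_ae (fun n => ((Finset.measurable_sum _ fun i _ =>
      hσm.comp (measurable_const.sub (h.measurable_W.comp (measurable_fst.comp
        (measurable_pi_apply i))))).div_const _).aestronglyMeasurable) hae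
  have hG : TendstoInMeasure P (fun n (ω : ℕ → E × E) =>
      (∑ i ∈ range n, Real.sigmoid (dhat n ω - W (ω i).1)) / n) atTop (fun _ => G) := by
    refine tendstoInMeasure_of_sub_tendstoInMeasure_zero hGfix
      (tendstoInMeasure_zero_of_abs_le_mul hT one_pos fun n ω => ?_)
    have hδ : 0 ≤ 1 / 4 * |dhat n ω - ΔF| := by positivity
    have hcl : ∀ i < n, |Real.sigmoid (dhat n ω - W (ω i).1) - Real.sigmoid (ΔF - W (ω i).1)|
        ≤ 1 / 4 * |dhat n ω - ΔF| := fun i _ => by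
      have e1 := abs_sigmoid_sub_sigmoid_le (dhat n ω - W (ω i).1) (ΔF - W (ω i).1)
      rwa [show dhat n ω - W (ω i).1 - (ΔF - W (ω i).1) = dhat n ω - ΔF by ring] at e1
    have hb := abs_sampleMean_sub_le_of_close hδ hcl
    unfold Scoring.sampleMean at hb
    refine hb.trans ?_
    rw [abs_mul, abs_of_pos (by positivity : (0 : ℝ) < (Wn n : ℝ) + 1), one_mul]
    nlinarith [abs_nonneg (dhat n ω - ΔF), (Nat.cast_nonneg (Wn n) : (0 : ℝ) ≤ Wn n)]
  -- (5) Slutsky: `√n (d̂_n − ΔF) · Ĝ_n ⇒ N(0, σ²_pair)`, then the scale `(√V̂_n)⁻¹ → (√σ²_pair)⁻¹`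
  have hGm : ∀ n, Measurable fun ω : ℕ → E × E =>
      (∑ i ∈ range n, Real.sigmoid (dhat n ω - W (ω i).1)) / n := fun n =>
    (Finset.measurable_sum _ fun i _ => hgi n i).div_const _
  have hXG := hU.continuous_comp_prodMk_of_tendstoInMeasure_const
    (g := fun p : ℝ × ℝ => p.1 * p.2) (by fun_prop) hG (fun n => (hGm n).aemeasurable)
  have hlawG : HasLaw (fun y : ℝ => id y * G)
      (gaussianReal 0 (NNReal.mk (G ^ 2) (sq_nonneg _) * Real.toNNReal (σ2 / G ^ 2)))
      (gaussianReal 0 (Real.toNNReal (σ2 / G ^ 2))) := by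
    have hh := gaussianReal_mul_const (HasLaw.id (μ := gaussianReal 0 (Real.toNNReal (σ2 / G ^ 2)))) G
    rwa [mul_zero] at hh
  have hBm : ∀ n, Measurable fun ω : ℕ → E × E => (Real.sqrt (Vh n ω))⁻¹ := fun n =>
    (measurable_gammaWindow_of (hψi n) n (Wn n)).sqrt.inv
  have hB : TendstoInMeasure P (fun n ω => (Real.sqrt (Vh n ω))⁻¹) atTop
      (fun _ => (Real.sqrt σ2)⁻¹) :=
    tendstoInMeasure_comp_continuousAt (g := fun v : ℝ => (Real.sqrt v)⁻¹) hV
      (Real.continuous_sqrt.continuousAt.inv₀ (Real.sqrt_pos.2 hσ).ne') hBm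
  have key := tendsto_measure_abs_mul_le_of_clt_of_tendstoInMeasure hBm hlawG hXG hB hz
  have hone : NNReal.mk (((Real.sqrt σ2)⁻¹) ^ 2) (sq_nonneg _)
      * (NNReal.mk (G ^ 2) (sq_nonneg _) * Real.toNNReal (σ2 / G ^ 2)) = 1 := by
    apply NNReal.eq
    rw [NNReal.coe_mul, NNReal.coe_mul, NNReal.coe_mk, NNReal.coe_mk,
      Real.coe_toNNReal _ (div_nonneg hσ.le (sq_nonneg _)), NNReal.coe_one, inv_pow,
      Real.sq_sqrt hσ.le]
    field_simp
  rw [hone] at key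
  -- (6) the two events coincide off `{V̂_n ≤ 0} ∪ {n = 0}`, whose probability vanishes
  set Bn : ℕ → Set (ℕ → E × E) := fun n => {ω | Vh n ω ≤ 0} ∪ {ω | n = 0} with hBdef
  have hBt : Tendsto (fun n => P (Bn n)) atTop (𝓝 0) := by
    have h1' : Tendsto (fun n => P {ω | Vh n ω ≤ 0}) atTop (𝓝 0) := by
      have hc := hV (ENNReal.ofReal σ2) (by simpa using hσ)
      refine tendsto_of_tendsto_of_tendsto_of_le_of_le tendsto_const_nhds hc (fun n => bot_le)
        fun n => measure_mono fun ω hω => ?_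
      simp only [Set.mem_setOf_eq] at hω ⊢
      rw [edist_dist, Real.dist_eq]
      refine ENNReal.ofReal_le_ofReal ?_
      rw [abs_sub_comm]
      linarith [le_abs_self (σ2 - Vh n ω)]
    have h2' : Tendsto (fun n : ℕ => P {ω : ℕ → E × E | n = 0}) atTop (𝓝 0) := by
      refine tendsto_const_nhds.congr' ?_
      filter_upwards [Filter.eventually_gt_atTop 0] with n hn
      rw [show {ω : ℕ → E × E | n = 0} = ∅ from Set.eq_empty_of_forall_notMem fun ω hω => hn.ne' hω,
        measure_empty]
    have h12 := h1'.add h2'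
    rw [add_zero] at h12
    exact tendsto_of_tendsto_of_tendsto_of_le_of_le tendsto_const_nhds h12 (fun n => bot_le)
      fun n => measure_union_le _ _
  have hGnpos : ∀ {n : ℕ}, 0 < n → ∀ ω : ℕ → E × E,
      0 < (∑ i ∈ range n, Real.sigmoid (dhat n ω - W (ω i).1)) / n := by
    intro n hn ω
    have hn' : (0 : ℝ) < n := by exact_mod_cast hn
    exact div_pos (Finset.sum_pos (fun i _ => Real.sigmoid_pos _)
      (Finset.nonempty_range_iff.2 hn.ne')) hn'
  refine tendsto_measure_of_eq_off_vanishing hBt (fun n => ?_) key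
  ext ω
  simp only [hBdef, Set.mem_inter_iff, Set.mem_compl_iff, Set.mem_union, Set.mem_setOf_eq, not_or,
    not_le]
  constructor
  · rintro ⟨hle, hVpos, hn⟩
    refine ⟨?_, hVpos, hn⟩
    have hn0 : 0 < n := Nat.pos_of_ne_zero hn
    have hiff := abs_studentizedLog_le_iff hn0 (z := z) (D := dhat n ω - ΔF) hVpos (hGnpos hn0 ω)
    rw [hVh] at hiff
    exact hiff.1 (by simpa [mul_assoc] using hle)
  · rintro ⟨hle, hVpos, hn⟩
    refine ⟨?_, hVpos, hn⟩
    have hn0 : 0 < n := Nat.pos_of_ne_zero hn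
    have hiff := abs_studentizedLog_le_iff hn0 (z := z) (D := dhat n ω - ΔF) hVpos (hGnpos hn0 ω)
    rw [hVh] at hiff
    simpa [mul_assoc] using hiff.2 hle

end CrooksPair

end Summit.Ventures.LatticeQCDFlow.Exactness.GeneralNCMC
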